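import Literature.Analysis.FluidPDE.LeiZhang2017AxisymmetricCriteria
import HarnessLib

/-!
# Lei–Zhang 2017, Cor. 1.3 (logarithmic axis modulus): proofs

Analysis/FluidPDE proof file (no definitions, no named facts, no `sorry`), sibling of
`LeiZhang2017AxisymmetricCriteria.lean`, on the discharge path of the named fact
`Literature.Analysis.FluidPDE.LeiZhang2017_logModulus_regularity` (Z. Lei, Q. S. Zhang,
*Criticality of the axially symmetric Navier–Stokes equations*, Pacific J. Math. 289 (2017)
169–187 = arXiv:1505.02628, Cor. 1.3: a local strong axisymmetric solution with
`sup_{0 ≤ t < T} |Γ(t, r, z)| ≤ C₁ |ln r|^{−2}` for `r ≤ δ₀ ∈ (0, 1/2)`, `C₁ > 1`, is regular).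

## Contents

* `div_log_sq_le_rpow_of_le_exp`: for `C₁ ≥ 1` and `0 < r ≤ exp (−C₁²)`,
  `C₁ / (log r)² ≤ |log r|^{−3/2}` — Lei–Zhang's modulus is below Wei's near the axis.
* `LeiZhang2017_logModulus_regularity_of_wei2016 :
    Wei2016_logModulus_regularity → LeiZhang2017_logModulus_regularity` — the remark of
  D. Wei, *Regularity criterion to the axially symmetric Navier–Stokes equations*, J. Math. Anal.
  Appl. 435 (2016) 402–413 = arXiv:1508.03318, §1 (held text p. 4): "In [1] global regularity is
  obtained if `|Γ| ≤ C|ln r|^{−2}` for some `C > 0`. Clearly, our Corollary 1.1 improves the one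
  in [1]": with `δ₀' = min δ₀ (exp (−C₁²))` the hypothesis of Lei–Zhang's Cor. 1.3 implies that of
  Wei's Cor. 1.1, all other data of the two rendered statements being identical.

The printed proof of Cor. 1.3 itself (Lei–Zhang 2017, §§2–3: the form boundedness condition
from the logarithmic modulus by a Hardy-type inequality, the critical `(J, Ω)` energy estimates,
Lemma 2.1, and the `L⁴`/Serrin bootstrap) is the subject of the later sections of this file's
lineage; nothing of it is asserted here.

## Mathlib / tree search

`lean search 'logModulus|Wei2016|LeiZhang2017'`: only the statement file (the three named facts,
`inv_log_sq_le_rpow`, `leiZhang_modulus_le_wei_modulus` — the comparison for `|log r| ≥ 1` with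
the constant on the other side). Mathlib: `Real.rpow_le_rpow`, `Real.rpow_sub`, `Real.sqrt_eq_rpow`.

## References

* Z. Lei, Q. S. Zhang, Pacific J. Math. 289 (2017) 169–187, arXiv:1505.02628, Cor. 1.3 (p. 4)
  and its proof (end of §2, pp. 7–8). [`LeiZhang2017`]
* D. Wei, J. Math. Anal. Appl. 435 (2016) 402–413, arXiv:1508.03318, Cor. 1.1 and the remark
  following it (§1, p. 4). [`Wei2016`]
-/

noncomputable section

open MeasureTheory Set Function Filter Topology TopologicalSpace
open scoped NNReal ENNReal

namespace Literature.Analysis.FluidPDE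

/-! ### Lei–Zhang's Cor. 1.3 from Wei's Cor. 1.1 -/

/-- Pointwise comparison of the two axis moduli in the range where Wei's is the larger one: for
`C₁ ≥ 1` and `0 < r ≤ exp (−C₁²)` one has `|log r| ≥ C₁²`, hence
`C₁ / (log r)² ≤ |log r|^{1/2} / (log r)² = |log r|^{−3/2}` (the elementary inequality behind
Wei 2016, §1: "In [1] global regularity is obtained if `|Γ| ≤ C|ln r|^{−2}` … Clearly, our
Corollary 1.1 improves the one in [1]"). [cite: Wei2016, §1 (remark after Cor. 1.1)] -/
theorem div_log_sq_le_rpow_of_le_exp {r C₁ : ℝ} (hC : 1 ≤ C₁) (hr : 0 < r)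
    (hre : r ≤ Real.exp (-(C₁ ^ 2))) :
    C₁ / Real.log r ^ 2 ≤ |Real.log r| ^ (-(3 / 2 : ℝ)) := by
  have hlog : Real.log r ≤ -(C₁ ^ 2) := by
    have h := Real.log_le_log hr hre
    rwa [Real.log_exp] at h
  have hC2 : 1 ≤ C₁ ^ 2 := by nlinarith
  have hL : C₁ ^ 2 ≤ |Real.log r| := by
    rw [abs_of_nonpos (by linarith)]
    linarith
  have hLpos : 0 < |Real.log r| := by linarith
  have hC1 : C₁ ≤ |Real.log r| ^ (1 / 2 : ℝ) := by
    have h1 : C₁ = (C₁ ^ 2) ^ (1 / 2 : ℝ) := by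
      rw [← Real.sqrt_eq_rpow, Real.sqrt_sq (by linarith)]
    rw [h1]
    exact Real.rpow_le_rpow (by positivity) hL (by norm_num)
  have hsq : Real.log r ^ 2 = |Real.log r| ^ (2 : ℝ) := by
    rw [← sq_abs, Real.rpow_two]
  calc C₁ / Real.log r ^ 2 ≤ |Real.log r| ^ (1 / 2 : ℝ) / Real.log r ^ 2 := by gcongr
    _ = |Real.log r| ^ (-(3 / 2 : ℝ)) := by
      rw [hsq, ← Real.rpow_sub hLpos]
      norm_num

/-- **Lei–Zhang 2017, Cor. 1.3 from Wei 2016, Cor. 1.1** (Wei 2016, §1: "In [1] global regularity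
is obtained if `|Γ| ≤ C|ln r|^{−2}` for some `C > 0`. Clearly, our Corollary 1.1 improves the one
in [1]"): given the hypothesis of Cor. 1.3 with `(δ₀, C₁)`, Wei's hypothesis holds with
`δ₀' = min δ₀ (exp (−C₁²)) ∈ (0, 1/2)`, because `C₁ (log r)⁻² ≤ |log r|^{−3/2}` for
`0 < r ≤ exp (−C₁²)` (`div_log_sq_le_rpow_of_le_exp`); all the other data of the two rendered
statements coincide.  So the named fact `LeiZhang2017_logModulus_regularity` is implied by the
named fact `Wei2016_logModulus_regularity`. [cite: Wei2016, §1 (remark after Cor. 1.1)] -/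
theorem LeiZhang2017_logModulus_regularity_of_wei2016 (hW : Wei2016_logModulus_regularity) :
    LeiZhang2017_logModulus_regularity := by
  intro δ₀ C₁ hδ₀ hδ₀' hC₁ T u p hT hcl hLH hdec haxi hΓ hmod
  have hδ₁pos : 0 < min δ₀ (Real.exp (-(C₁ ^ 2))) := lt_min hδ₀ (Real.exp_pos _)
  have hδ₁half : min δ₀ (Real.exp (-(C₁ ^ 2))) < 1 / 2 := (min_le_left _ _).trans_lt hδ₀'
  refine hW _ hδ₁pos hδ₁half T u p hT hcl hLH hdec haxi hΓ fun t ht x hr0 hrδ => ?_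
  calc |swirl (u t) x| ≤ C₁ / Real.log (cylRadius x) ^ 2 :=
        hmod t ht x (hrδ.trans (min_le_left _ _))
    _ ≤ |Real.log (cylRadius x)| ^ (-(3 / 2 : ℝ)) :=
        div_log_sq_le_rpow_of_le_exp hC₁.le hr0 (hrδ.trans (min_le_right _ _))

end Literature.Analysis.FluidPDE

end
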